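import Literature.MathematicalPhysics.QuantumLattice.HubbardTTPrimeCapCutDualRows
import Literature.MathematicalPhysics.QuantumLattice.HubbardOneBodyKinematicRows
import Literature.MathematicalPhysics.QuantumLattice.HubbardNNNHoppingTorusLimitCorrelator
import Literature.MathematicalPhysics.QuantumLattice.InfVolFermionStateTTPrimeMeanEnergyBox
import Literature.MathematicalPhysics.QuantumLattice.HubbardKineticEnergyDensity
import HarnessLib

/-!
# Ventures/CertifiedManyBodySolver — Observables/DiagHopChordRows.lean

HONEST FRAMING: one-sided certified FLOORS / CEILINGS on the DIAGONAL (next-nearest-neighbour) hopping energy per site of torus-limit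
ground states, derived at ZERO compute from two certified ENERGY rows at two values of `t′` (same `t, U, n`); a correlator bound at
kinematic scale; not an order statement; not informative vs print; not a superconductivity verdict. No definition, no claim node, no `sorry`.

Cell `hubbard-obs` (D-0042), seat p2 (stiffness), `prover-hubbard-obs-p2-g10-0`. The `t′`-CHORD: the `t′`-axis twin of hubbard-fast's
`U`-chord rows (`Literature/…/HubbardTTPrimeCapCutDualRows.lean` §8 `docc_le_chord_of_cap_of_cut` / `chord_le_docc_of_cap_of_cut`, whose conjugate
coordinate is the double occupancy `D(ω)`); here the conjugate coordinate of `t′` is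
`K₂(ω) = e_{Φ(0,1,0)}(ω) = ω.meanEnergy (hubbardTTPrimeFermionInteraction 0 1 0) 1`, the UNIT diagonal-hopping energy per site
(`= −Σ_{s∈{(1,1),(1,−1)}} Σ_σ Re ω(c†_0 c_{j_s} + c†_{j_s} c_0)` for translation-invariant `ω`; `|K₂(ω)| ≤ 16/π²` kinematically,
`IsTorusLimitOf.abs_meanEnergy_diagHop_le`). The mean energy is affine in the couplings
(`meanEnergy_hubbardTTPrime_affine`: `e_{Φ(t,t′_P,U)}(ω) = e_{Φ(t,t′_a,U)}(ω) + (t′_P − t′_a)·K₂(ω)` at equal `U`), so a CAP at `t′_P` and a CUT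
at `t′_a` bound `K₂`:

* §1 every state: `diagHop_le_chord_of_cap_of_cut` (`t′_a < t′_P`: `K₂(ω) ≤ (u − ℓ)/(t′_P − t′_a)`), `chord_le_diagHop_of_cap_of_cut`
  (`t′_P < t′_a`: `(ℓ − u)/(t′_a − t′_P) ≤ K₂(ω)`);
* §2 torus-limit ground states at `(t, t′_P, U)` (`U ≥ 0`, `0 ≤ n < 2`) fed from the certified energy table: the cap is a certified upper bound
  `e(t,t′_P,U,n) ≤ u` (`meanEnergy_hubbardTTPrime_eq_energyDensityTT'`), the cut a certified lower bound `ℓ ≤ e(t,t′_a,U,n)` at the OTHER `t′`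
  (the variational inequality `energyDensityTT'_le_meanEnergy_hubbardTTPrime`: the `t′_P` ground states are trial states at `t′_a`):
  `IsTorusLimitOf.diagHop_le_tchord_of_groundState`, `IsTorusLimitOf.tchord_le_diagHop_of_groundState`, and the CLASS forms
  `forall_torusLimit_diagHop_le_tchord`, `forall_torusLimit_tchord_le_diagHop` (hypothesis shape of the cell's rows);
* §3 transport along the `t′`-ray (hubbard-fast `IsTorusLimitOf.diagHopEnergy_anti_of_groundStates`: `K₂` is non-increasing in `t′` across
  torus-limit ground-state classes): a CEILING on `K₂` certified at `t′₀` holds at every `t′ ≥ t′₀`, a FLOOR at every `t′ ≤ t′₀`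
  (`forall_torusLimit_diagHop_le_of_le_tPrime`, `forall_torusLimit_le_diagHop_of_tPrime_le`);
* §4 the kinematic comparator in class form (`forall_torusLimit_abs_diagHop_le`: `|K₂| ≤ 16/π² < 1.6211390`).
The M3 instances (A0 = (8, 7/8, −¼) from #473 ∧ #445; A0′ = (8, 7/8, 0) from #354 ∧ #448; A3 = (8, 7/8, +¼) by transport) are in
`Certificates/HubbardSquare_n7o8_diaghop_tchord_rows.lean`.
* §5 (append, same seat): the DICTIONARY `meanEnergy_hubbardTTPrime_diagHop_eq_bondForm` — for translation-invariant `ω`,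
  `K₂(ω) = Σ_s (−1)·Σ_σ (Re ω(c†_0 c_{j_s}) + Re ω(c†_{j_s} c_0))` (`j₀ = (1,1)`, `j₁ = (1,−1)`): minus the next-nearest-neighbour hopping
  amplitude per site (two diagonal bonds, both spins) — and the class rows of §2 re-stated in that bond form
  (`forall_torusLimit_tchord_le_diagHopBond`: the nnn hopping amplitude `Σ_sΣ_σ Re ω(c†_0 c_{j_s} + h.c.) ≥ (lo − hi)/(t′_P − t′_a)`; `forall_torusLimit_diagHopBond_le_tchord`: `≤ (hi − lo)/(t′_a − t′_P)`).

References: D. P. Bertsekas, *Nonlinear Programming* (1999) Prop. 5.1.3 [Bertsekas1999NonlinearProgramming]; T. Koma, H. Tasaki, J. Stat. Phys. 76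
(1994) 745, §1 [KomaTasaki1994]; R. B. Griffiths, Phys. Rev. 152 (1966) 240, §II [Griffiths1966]; D. Ruelle, *Statistical Mechanics* (1969) §3.4 [Ruelle1969].
-/

noncomputable section

namespace Summit.Ventures.CertifiedManyBodySolver.Observables

open Literature.MathematicalPhysics.QuantumLattice
open Literature.MathematicalPhysics.QuantumLattice.ThermodynamicLimit
open Literature.Probability.LatticeModels
open Matrix Finset Filter Topology
open scoped Matrix BigOperators ComplexOrder

/-! ## §1 The `t′`-chord, every state -/

/-- **Upper `t′`-chord for the diagonal-hopping energy, every state** (anchor BELOW in `t′`): if a state `ω` obeys the cap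
`e_{Φ(t,t′_P,U)}(ω) ≤ u` and the cut `ℓ ≤ e_{Φ(t,t′_a,U)}(ω)` with `t′_a < t′_P` (same `t`, `U`), then `K₂(ω) ≤ (u − ℓ)/(t′_P − t′_a)`.
[cite: Bertsekas1999NonlinearProgramming, Prop. 5.1.3] [cite: KomaTasaki1994, §1] -/
theorem diagHop_le_chord_of_cap_of_cut (ω : InfVolFermionState 2) (t U : ℝ) {t'a t'P u ℓ : ℝ} (ht' : t'a < t'P)
    (hcap : ω.meanEnergy (hubbardTTPrimeFermionInteraction t t'P U) 1 ≤ u)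
    (hcut : ℓ ≤ ω.meanEnergy (hubbardTTPrimeFermionInteraction t t'a U) 1) :
    ω.meanEnergy (hubbardTTPrimeFermionInteraction 0 1 0) 1 ≤ (u - ℓ) / (t'P - t'a) := by
  have haff := ω.meanEnergy_hubbardTTPrime_affine t t'a U t'P U
  rw [sub_self, zero_mul, add_zero] at haff
  rw [le_div_iff₀ (sub_pos.2 ht')]
  nlinarith [haff, hcap, hcut]

/-- **Lower `t′`-chord for the diagonal-hopping energy, every state** (anchor ABOVE in `t′`): cap `e_{Φ(t,t′_P,U)}(ω) ≤ u`, cut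
`ℓ ≤ e_{Φ(t,t′_a,U)}(ω)` with `t′_P < t′_a` ⇒ `(ℓ − u)/(t′_a − t′_P) ≤ K₂(ω)`.
[cite: Bertsekas1999NonlinearProgramming, Prop. 5.1.3] [cite: KomaTasaki1994, §1] -/
theorem chord_le_diagHop_of_cap_of_cut (ω : InfVolFermionState 2) (t U : ℝ) {t'a t'P u ℓ : ℝ} (ht' : t'P < t'a)
    (hcap : ω.meanEnergy (hubbardTTPrimeFermionInteraction t t'P U) 1 ≤ u)
    (hcut : ℓ ≤ ω.meanEnergy (hubbardTTPrimeFermionInteraction t t'a U) 1) :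
    (ℓ - u) / (t'a - t'P) ≤ ω.meanEnergy (hubbardTTPrimeFermionInteraction 0 1 0) 1 := by
  have haff := ω.meanEnergy_hubbardTTPrime_affine t t'a U t'P U
  rw [sub_self, zero_mul, add_zero] at haff
  rw [div_le_iff₀ (sub_pos.2 ht')]
  nlinarith [haff, hcap, hcut]

/-! ## §2 Torus-limit ground states fed from the certified energy table -/

/-- **Upper `t′`-chord for torus-limit ground states.** For a torus limit `ω` of unit `(rectN n L, S^z = 0)`-sector ground states of
`hubbardTorusTT' L t t′_P U` (`U ≥ 0`, `0 ≤ n < 2`), a certified cap `e(t,t′_P,U,n) ≤ u` and a certified cut `ℓ ≤ e(t,t′_a,U,n)` at an anchor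
`t′_a < t′_P`: `K₂(ω) ≤ (u − ℓ)/(t′_P − t′_a)`. [cite: KomaTasaki1994, §1] [cite: Ruelle1969, §3.4] -/
theorem IsTorusLimitOf.diagHop_le_tchord_of_groundState (t : ℝ) {t'P U : ℝ} (hU : 0 ≤ U) {n : ℝ} (hn0 : 0 ≤ n) (hn2 : n < 2)
    {ω : InfVolFermionState 2} {ψ : ∀ L, Fock (Orb (FermionTorus 2 L))} {Ls : ℕ → ℕ}
    (h : ω.IsTorusLimitOf ψ Ls) (hLs : Tendsto Ls atTop atTop)
    (hψ : ∀ j, IsGroundStateInSector (hubbardTorusTT' (Ls j) t t'P U) (rectN n (Ls j)) 0 (ψ (Ls j)))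
    (h1 : ∀ j, star (ψ (Ls j)) ⬝ᵥ ψ (Ls j) = 1)
    {u : ℝ} (hu : energyDensityTT' t t'P U n ≤ u) {t'a ℓ : ℝ} (ht' : t'a < t'P) (hℓ : ℓ ≤ energyDensityTT' t t'a U n) :
    ω.meanEnergy (hubbardTTPrimeFermionInteraction 0 1 0) 1 ≤ (u - ℓ) / (t'P - t'a) := by
  have hN : ∀ j, IsNParticle (rectN n (Ls j)) (ψ (Ls j)) := fun j => ((mem_szSector_iff _ _ _).1 (hψ j).1).1
  have hcap : ω.meanEnergy (hubbardTTPrimeFermionInteraction t t'P U) 1 ≤ u := by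
    rw [h.meanEnergy_hubbardTTPrime_eq_energyDensityTT' t t'P hU hn0 hn2 hLs hψ h1]; exact hu
  have hcut : ℓ ≤ ω.meanEnergy (hubbardTTPrimeFermionInteraction t t'a U) 1 :=
    hℓ.trans (h.energyDensityTT'_le_meanEnergy_hubbardTTPrime t t'a hU hn0 hn2 hLs hN h1)
  exact diagHop_le_chord_of_cap_of_cut ω t U ht' hcap hcut

/-- **Lower `t′`-chord for torus-limit ground states** (anchor ABOVE in `t′`): torus limit of unit sector ground states at `(t, t′_P, U)`
(`U ≥ 0`, `0 ≤ n < 2`), certified cap `e(t,t′_P,U,n) ≤ u`, certified cut `ℓ ≤ e(t,t′_a,U,n)` with `t′_P < t′_a`: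
`(ℓ − u)/(t′_a − t′_P) ≤ K₂(ω)`. [cite: KomaTasaki1994, §1] [cite: Ruelle1969, §3.4] -/
theorem IsTorusLimitOf.tchord_le_diagHop_of_groundState (t : ℝ) {t'P U : ℝ} (hU : 0 ≤ U) {n : ℝ} (hn0 : 0 ≤ n) (hn2 : n < 2)
    {ω : InfVolFermionState 2} {ψ : ∀ L, Fock (Orb (FermionTorus 2 L))} {Ls : ℕ → ℕ}
    (h : ω.IsTorusLimitOf ψ Ls) (hLs : Tendsto Ls atTop atTop)
    (hψ : ∀ j, IsGroundStateInSector (hubbardTorusTT' (Ls j) t t'P U) (rectN n (Ls j)) 0 (ψ (Ls j)))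
    (h1 : ∀ j, star (ψ (Ls j)) ⬝ᵥ ψ (Ls j) = 1)
    {u : ℝ} (hu : energyDensityTT' t t'P U n ≤ u) {t'a ℓ : ℝ} (ht' : t'P < t'a) (hℓ : ℓ ≤ energyDensityTT' t t'a U n) :
    (ℓ - u) / (t'a - t'P) ≤ ω.meanEnergy (hubbardTTPrimeFermionInteraction 0 1 0) 1 := by
  have hN : ∀ j, IsNParticle (rectN n (Ls j)) (ψ (Ls j)) := fun j => ((mem_szSector_iff _ _ _).1 (hψ j).1).1
  have hcap : ω.meanEnergy (hubbardTTPrimeFermionInteraction t t'P U) 1 ≤ u := by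
    rw [h.meanEnergy_hubbardTTPrime_eq_energyDensityTT' t t'P hU hn0 hn2 hLs hψ h1]; exact hu
  have hcut : ℓ ≤ ω.meanEnergy (hubbardTTPrimeFermionInteraction t t'a U) 1 :=
    hℓ.trans (h.energyDensityTT'_le_meanEnergy_hubbardTTPrime t t'a hU hn0 hn2 hLs hN h1)
  exact chord_le_diagHop_of_cap_of_cut ω t U ht' hcap hcut

/-- **CLASS form of the upper `t′`-chord** (`t = 1`; the hypothesis shape of the cell's rows): `U ≥ 0`, `0 ≤ n < 2`, certified cap
`e(1,t′_P,U,n) ≤ hi` and certified floor `lo ≤ e(1,t′_a,U,n)` at `t′_a < t′_P` ⇒ for EVERY torus limit of unit `(rectN n L, S^z = 0)`-sector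
ground states of `hubbardTorusTT' L 1 t′_P U`: `K₂(ω) ≤ (hi − lo)/(t′_P − t′_a)`. [cite: KomaTasaki1994, §1] -/
theorem forall_torusLimit_diagHop_le_tchord {t'P U n : ℝ} (hU : 0 ≤ U) (hn0 : 0 ≤ n) (hn2 : n < 2) {hi lo : ℚ} {t'a : ℝ}
    (ht' : t'a < t'P) (hcap : energyDensityTT' 1 t'P U n ≤ ((hi : ℚ) : ℝ)) (hfloor : ((lo : ℚ) : ℝ) ≤ energyDensityTT' 1 t'a U n) :
    ∀ (ω : InfVolFermionState 2) (Ls : ℕ → ℕ) (ψ : ∀ L, Fock (Orb (FermionTorus 2 L))),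
      Tendsto Ls atTop atTop →
      (∀ j, IsGroundStateInSector (hubbardTorusTT' (Ls j) 1 t'P U) (rectN n (Ls j)) 0 (ψ (Ls j))) →
      (∀ j, star (ψ (Ls j)) ⬝ᵥ ψ (Ls j) = 1) → ω.IsTorusLimitOf ψ Ls →
      ω.meanEnergy (hubbardTTPrimeFermionInteraction 0 1 0) 1 ≤ (((hi : ℚ) : ℝ) - ((lo : ℚ) : ℝ)) / (t'P - t'a) :=
  fun _ω _Ls _ψ hLs hψ h1 hω =>
    IsTorusLimitOf.diagHop_le_tchord_of_groundState 1 hU hn0 hn2 hω hLs hψ h1 hcap ht' hfloor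

/-- **CLASS form of the lower `t′`-chord** (`t = 1`): `U ≥ 0`, `0 ≤ n < 2`, certified cap `e(1,t′_P,U,n) ≤ hi` and certified floor
`lo ≤ e(1,t′_a,U,n)` at `t′_P < t′_a` ⇒ for every torus-limit ground state of the `(U, n, t′_P)` class: `(lo − hi)/(t′_a − t′_P) ≤ K₂(ω)`.
[cite: KomaTasaki1994, §1] -/
theorem forall_torusLimit_tchord_le_diagHop {t'P U n : ℝ} (hU : 0 ≤ U) (hn0 : 0 ≤ n) (hn2 : n < 2) {hi lo : ℚ} {t'a : ℝ}
    (ht' : t'P < t'a) (hcap : energyDensityTT' 1 t'P U n ≤ ((hi : ℚ) : ℝ)) (hfloor : ((lo : ℚ) : ℝ) ≤ energyDensityTT' 1 t'a U n) :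
    ∀ (ω : InfVolFermionState 2) (Ls : ℕ → ℕ) (ψ : ∀ L, Fock (Orb (FermionTorus 2 L))),
      Tendsto Ls atTop atTop →
      (∀ j, IsGroundStateInSector (hubbardTorusTT' (Ls j) 1 t'P U) (rectN n (Ls j)) 0 (ψ (Ls j))) →
      (∀ j, star (ψ (Ls j)) ⬝ᵥ ψ (Ls j) = 1) → ω.IsTorusLimitOf ψ Ls →
      (((lo : ℚ) : ℝ) - ((hi : ℚ) : ℝ)) / (t'a - t'P) ≤ ω.meanEnergy (hubbardTTPrimeFermionInteraction 0 1 0) 1 :=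
  fun _ω _Ls _ψ hLs hψ h1 hω =>
    IsTorusLimitOf.tchord_le_diagHop_of_groundState 1 hU hn0 hn2 hω hLs hψ h1 hcap ht' hfloor

/-! ## §3 Transport along the `t′`-ray (the diagonal-hopping energy is non-increasing in `t′`) -/

/-- **A certified CEILING on `K₂` transports UP the `t′`-ray.** `U ≥ 0`, `0 ≤ n < 2`, `t′₀ ≤ t′`: if `K₂(ω) ≤ X` for every torus limit of
unit `(rectN n L, S^z = 0)`-sector ground states of `hubbardTorusTT' L t t′₀ U`, then `K₂(ω′) ≤ X` for every such torus limit at `t′`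
(`IsTorusLimitOf.diagHopEnergy_anti_of_groundStates` against an inhabitant of the class at `t′₀`, `exists_isTorusLimitOf_sectorGroundState_TT'`).
[cite: Griffiths1966, §II] [cite: KomaTasaki1994, §1] -/
theorem forall_torusLimit_diagHop_le_of_le_tPrime (t : ℝ) {t'₀ t' U : ℝ} (hU : 0 ≤ U) (ht' : t'₀ ≤ t') {n : ℝ} (hn0 : 0 ≤ n)
    (hn2 : n < 2) {X : ℝ}
    (hX : ∀ (ω : InfVolFermionState 2) (Ls : ℕ → ℕ) (ψ : ∀ L, Fock (Orb (FermionTorus 2 L))),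
      Tendsto Ls atTop atTop →
      (∀ j, IsGroundStateInSector (hubbardTorusTT' (Ls j) t t'₀ U) (rectN n (Ls j)) 0 (ψ (Ls j))) →
      (∀ j, star (ψ (Ls j)) ⬝ᵥ ψ (Ls j) = 1) → ω.IsTorusLimitOf ψ Ls →
      ω.meanEnergy (hubbardTTPrimeFermionInteraction 0 1 0) 1 ≤ X) :
    ∀ (ω : InfVolFermionState 2) (Ls : ℕ → ℕ) (ψ : ∀ L, Fock (Orb (FermionTorus 2 L))),
      Tendsto Ls atTop atTop →
      (∀ j, IsGroundStateInSector (hubbardTorusTT' (Ls j) t t' U) (rectN n (Ls j)) 0 (ψ (Ls j))) →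
      (∀ j, star (ψ (Ls j)) ⬝ᵥ ψ (Ls j) = 1) → ω.IsTorusLimitOf ψ Ls →
      ω.meanEnergy (hubbardTTPrimeFermionInteraction 0 1 0) 1 ≤ X := by
  intro ω Ls ψ hLs hψ h1 hω
  rcases eq_or_lt_of_le ht' with rfl | hlt
  · exact hX ω Ls ψ hLs hψ h1 hω
  · obtain ⟨ψA, φ, ωA, hφ, hψA, hψA1, hωA, -, -, -⟩ :=
      exists_isTorusLimitOf_sectorGroundState_TT' t t'₀ U hn0 hn2.le (Ls := id) tendsto_id
    have hLφ : Tendsto (id ∘ φ : ℕ → ℕ) atTop atTop := tendsto_id.comp hφ.tendsto_atTop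
    have hmono := InfVolFermionState.IsTorusLimitOf.diagHopEnergy_anti_of_groundStates t hlt hU hn0 hn2 hωA hLφ
      (fun j => hψA _) (fun j => hψA1 _) hω hLs hψ h1
    exact hmono.trans (hX ωA (id ∘ φ) ψA hLφ (fun j => hψA _) (fun j => hψA1 _) hωA)

/-- **A certified FLOOR on `K₂` transports DOWN the `t′`-ray.** `U ≥ 0`, `0 ≤ n < 2`, `t′ ≤ t′₀`: if `X ≤ K₂(ω)` on the torus-limit
ground-state class at `t′₀`, then `X ≤ K₂(ω′)` on the class at `t′`. [cite: Griffiths1966, §II] [cite: KomaTasaki1994, §1] -/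
theorem forall_torusLimit_le_diagHop_of_tPrime_le (t : ℝ) {t'₀ t' U : ℝ} (hU : 0 ≤ U) (ht' : t' ≤ t'₀) {n : ℝ} (hn0 : 0 ≤ n)
    (hn2 : n < 2) {X : ℝ}
    (hX : ∀ (ω : InfVolFermionState 2) (Ls : ℕ → ℕ) (ψ : ∀ L, Fock (Orb (FermionTorus 2 L))),
      Tendsto Ls atTop atTop →
      (∀ j, IsGroundStateInSector (hubbardTorusTT' (Ls j) t t'₀ U) (rectN n (Ls j)) 0 (ψ (Ls j))) →
      (∀ j, star (ψ (Ls j)) ⬝ᵥ ψ (Ls j) = 1) → ω.IsTorusLimitOf ψ Ls →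
      X ≤ ω.meanEnergy (hubbardTTPrimeFermionInteraction 0 1 0) 1) :
    ∀ (ω : InfVolFermionState 2) (Ls : ℕ → ℕ) (ψ : ∀ L, Fock (Orb (FermionTorus 2 L))),
      Tendsto Ls atTop atTop →
      (∀ j, IsGroundStateInSector (hubbardTorusTT' (Ls j) t t' U) (rectN n (Ls j)) 0 (ψ (Ls j))) →
      (∀ j, star (ψ (Ls j)) ⬝ᵥ ψ (Ls j) = 1) → ω.IsTorusLimitOf ψ Ls →
      X ≤ ω.meanEnergy (hubbardTTPrimeFermionInteraction 0 1 0) 1 := by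
  intro ω Ls ψ hLs hψ h1 hω
  rcases eq_or_lt_of_le ht' with rfl | hlt
  · exact hX ω Ls ψ hLs hψ h1 hω
  · obtain ⟨ψP, φ, ωP, hφ, hψP, hψP1, hωP, -, -, -⟩ :=
      exists_isTorusLimitOf_sectorGroundState_TT' t t'₀ U hn0 hn2.le (Ls := id) tendsto_id
    have hLφ : Tendsto (id ∘ φ : ℕ → ℕ) atTop atTop := tendsto_id.comp hφ.tendsto_atTop
    have hmono := InfVolFermionState.IsTorusLimitOf.diagHopEnergy_anti_of_groundStates t hlt hU hn0 hn2 hω hLs hψ h1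
      hωP hLφ (fun j => hψP _) (fun j => hψP1 _)
    exact (hX ωP (id ∘ φ) ψP hLφ (fun j => hψP _) (fun j => hψP1 _) hωP).trans hmono

/-! ## §4 The kinematic comparator in class form -/

/-- **Kinematic range of `K₂` on every class**: for every torus limit `ω` of unit `(rectN n L, S^z = 0)`-sector ground states of
`hubbardTorusTT' L t t′ U` (`0 ≤ n < 2`): `|K₂(ω)| ≤ 16/π²` and `16/π² < 1.6211390` (hubbard-fast `IsTorusLimitOf.abs_meanEnergy_diagHop_le`;
the one-body bathtub of the diagonal band). [cite: KomaTasaki1994, §1] -/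
theorem forall_torusLimit_abs_diagHop_le (t t' U : ℝ) {n : ℝ} (hn0 : 0 ≤ n) (hn2 : n < 2) :
    ∀ (ω : InfVolFermionState 2) (Ls : ℕ → ℕ) (ψ : ∀ L, Fock (Orb (FermionTorus 2 L))),
      Tendsto Ls atTop atTop →
      (∀ j, IsGroundStateInSector (hubbardTorusTT' (Ls j) t t' U) (rectN n (Ls j)) 0 (ψ (Ls j))) →
      (∀ j, star (ψ (Ls j)) ⬝ᵥ ψ (Ls j) = 1) → ω.IsTorusLimitOf ψ Ls →
      |ω.meanEnergy (hubbardTTPrimeFermionInteraction 0 1 0) 1| ≤ 16 / Real.pi ^ 2 ∧ 16 / Real.pi ^ 2 < (1.6211390 : ℝ) := by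
  intro ω Ls ψ hLs hψ h1 hω
  have hN : ∀ j, IsNParticle (rectN n (Ls j)) (ψ (Ls j)) := fun j => ((mem_szSector_iff _ _ _).1 (hψ j).1).1
  refine ⟨hω.abs_meanEnergy_diagHop_le hn0 hn2 hLs hN h1, ?_⟩
  have hπ : (3.14159265358979323846 : ℝ) < Real.pi := Real.pi_gt_d20
  have hpos : (0 : ℝ) < Real.pi ^ 2 := by positivity
  have hsq : (9.869604401 : ℝ) < Real.pi ^ 2 := by nlinarith
  rw [div_lt_iff₀ hpos]
  linarith

/-! ## §5 Dictionary: `K₂` is minus the next-nearest-neighbour hopping amplitude per site (bond form), and the bond-form class rows -/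

/-- **Dictionary.** For a translation-invariant state `ω` on `ℤ²`,
`e_{Φ(0,1,0)}(ω) = Σ_s (−1)·Σ_σ (Re ω(c†_0 c_{j_s}) + Re ω(c†_{j_s} c_0))` (`j₀ = (1,1)`, `j₁ = (1,−1)`): the unit diagonal-hopping energy per
site is minus the next-nearest-neighbour hopping amplitude summed over the two diagonal bonds through the origin and both spins (the `t = U = 0`
part of `IsTranslationInvariant.meanEnergy_hubbardTTPrime_eq` vanishes; `diagHoppingFermionInteraction_apply_pair`).
[cite: KomaTasaki1994, §1] -/
theorem meanEnergy_hubbardTTPrime_diagHop_eq_bondForm {ω : InfVolFermionState 2} (hω : ω.IsTranslationInvariant) :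
    ω.meanEnergy (hubbardTTPrimeFermionInteraction 0 1 0) 1 =
      ∑ s : Fin 2, -(1 : ℝ) * ∑ σ : Fin 2,
        ((ω.expect {0, 0 + diagVec s}
            ((cAt 0 (mem_insert_self _ _) σ)ᴴ * cAt (0 + diagVec s) (mem_insert_of_mem (mem_singleton_self _)) σ)).re +
          (ω.expect {0, 0 + diagVec s}
            ((cAt (0 + diagVec s) (mem_insert_of_mem (mem_singleton_self _)) σ)ᴴ * cAt 0 (mem_insert_self _ _) σ)).re) := by
  rw [hω.meanEnergy_hubbardTTPrime_eq 1 0 0, hω.hubbardEnergyDensity_eq_docc_add_hopping 0 0]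
  simp only [zero_mul, neg_zero, Finset.sum_const_zero, zero_add]
  refine Finset.sum_congr rfl fun s _ => ?_
  rw [diagHoppingFermionInteraction_apply_pair, map_smul, smul_eq_mul, map_sum]
  simp only [map_add, Complex.ofReal_one, neg_mul, one_mul, Complex.neg_re, Complex.re_sum, Complex.add_re]

/-- **Bond form of the upper `t′`-chord, CLASS form** (`t = 1`, `U ≥ 0`, `0 ≤ n < 2`, cap at `t′_P`, floor at `t′_a < t′_P`): for every
torus-limit ground state of the `(U, n, t′_P)` class the next-nearest-neighbour hopping amplitude per site is AT LEAST `(lo − hi)/(t′_P − t′_a)`: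
`(lo − hi)/(t′_P − t′_a) ≤ Σ_s Σ_σ (Re ω(c†_0 c_{j_s}) + Re ω(c†_{j_s} c_0))`. [cite: KomaTasaki1994, §1] -/
theorem forall_torusLimit_tchord_le_diagHopBond {t'P U n : ℝ} (hU : 0 ≤ U) (hn0 : 0 ≤ n) (hn2 : n < 2) {hi lo : ℚ} {t'a : ℝ}
    (ht' : t'a < t'P) (hcap : energyDensityTT' 1 t'P U n ≤ ((hi : ℚ) : ℝ)) (hfloor : ((lo : ℚ) : ℝ) ≤ energyDensityTT' 1 t'a U n) :
    ∀ (ω : InfVolFermionState 2) (Ls : ℕ → ℕ) (ψ : ∀ L, Fock (Orb (FermionTorus 2 L))),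
      Tendsto Ls atTop atTop →
      (∀ j, IsGroundStateInSector (hubbardTorusTT' (Ls j) 1 t'P U) (rectN n (Ls j)) 0 (ψ (Ls j))) →
      (∀ j, star (ψ (Ls j)) ⬝ᵥ ψ (Ls j) = 1) → ω.IsTorusLimitOf ψ Ls →
      (((lo : ℚ) : ℝ) - ((hi : ℚ) : ℝ)) / (t'P - t'a) ≤ ∑ s : Fin 2, ∑ σ : Fin 2,
        ((ω.expect {0, 0 + diagVec s}
            ((cAt 0 (mem_insert_self _ _) σ)ᴴ * cAt (0 + diagVec s) (mem_insert_of_mem (mem_singleton_self _)) σ)).re +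
          (ω.expect {0, 0 + diagVec s}
            ((cAt (0 + diagVec s) (mem_insert_of_mem (mem_singleton_self _)) σ)ᴴ * cAt 0 (mem_insert_self _ _) σ)).re) := by
  intro ω Ls ψ hLs hψ h1 hω
  have h := forall_torusLimit_diagHop_le_tchord hU hn0 hn2 ht' hcap hfloor ω Ls ψ hLs hψ h1 hω
  rw [meanEnergy_hubbardTTPrime_diagHop_eq_bondForm hω.isTranslationInvariant] at h
  have hsum : ∑ s : Fin 2, -(1 : ℝ) * ∑ σ : Fin 2,
        ((ω.expect {0, 0 + diagVec s}
            ((cAt 0 (mem_insert_self _ _) σ)ᴴ * cAt (0 + diagVec s) (mem_insert_of_mem (mem_singleton_self _)) σ)).re +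
          (ω.expect {0, 0 + diagVec s}
            ((cAt (0 + diagVec s) (mem_insert_of_mem (mem_singleton_self _)) σ)ᴴ * cAt 0 (mem_insert_self _ _) σ)).re) =
      -(∑ s : Fin 2, ∑ σ : Fin 2,
        ((ω.expect {0, 0 + diagVec s}
            ((cAt 0 (mem_insert_self _ _) σ)ᴴ * cAt (0 + diagVec s) (mem_insert_of_mem (mem_singleton_self _)) σ)).re +
          (ω.expect {0, 0 + diagVec s}
            ((cAt (0 + diagVec s) (mem_insert_of_mem (mem_singleton_self _)) σ)ᴴ * cAt 0 (mem_insert_self _ _) σ)).re)) := by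
    rw [← Finset.sum_neg_distrib]
    exact Finset.sum_congr rfl fun s _ => by ring
  rw [hsum] at h
  have hneg : -((((hi : ℚ) : ℝ) - ((lo : ℚ) : ℝ)) / (t'P - t'a)) = (((lo : ℚ) : ℝ) - ((hi : ℚ) : ℝ)) / (t'P - t'a) := by ring
  linarith

/-- **Bond form of the lower `t′`-chord, CLASS form** (`t = 1`, `U ≥ 0`, `0 ≤ n < 2`, cap at `t′_P`, floor at `t′_a > t′_P`): for every
torus-limit ground state of the `(U, n, t′_P)` class the next-nearest-neighbour hopping amplitude per site is AT MOST `(hi − lo)/(t′_a − t′_P)`: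
`Σ_s Σ_σ (Re ω(c†_0 c_{j_s}) + Re ω(c†_{j_s} c_0)) ≤ (hi − lo)/(t′_a − t′_P)`. [cite: KomaTasaki1994, §1] -/
theorem forall_torusLimit_diagHopBond_le_tchord {t'P U n : ℝ} (hU : 0 ≤ U) (hn0 : 0 ≤ n) (hn2 : n < 2) {hi lo : ℚ} {t'a : ℝ}
    (ht' : t'P < t'a) (hcap : energyDensityTT' 1 t'P U n ≤ ((hi : ℚ) : ℝ)) (hfloor : ((lo : ℚ) : ℝ) ≤ energyDensityTT' 1 t'a U n) :
    ∀ (ω : InfVolFermionState 2) (Ls : ℕ → ℕ) (ψ : ∀ L, Fock (Orb (FermionTorus 2 L))),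
      Tendsto Ls atTop atTop →
      (∀ j, IsGroundStateInSector (hubbardTorusTT' (Ls j) 1 t'P U) (rectN n (Ls j)) 0 (ψ (Ls j))) →
      (∀ j, star (ψ (Ls j)) ⬝ᵥ ψ (Ls j) = 1) → ω.IsTorusLimitOf ψ Ls →
      ∑ s : Fin 2, ∑ σ : Fin 2,
        ((ω.expect {0, 0 + diagVec s}
            ((cAt 0 (mem_insert_self _ _) σ)ᴴ * cAt (0 + diagVec s) (mem_insert_of_mem (mem_singleton_self _)) σ)).re +
          (ω.expect {0, 0 + diagVec s}
            ((cAt (0 + diagVec s) (mem_insert_of_mem (mem_singleton_self _)) σ)ᴴ * cAt 0 (mem_insert_self _ _) σ)).re) ≤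
        (((hi : ℚ) : ℝ) - ((lo : ℚ) : ℝ)) / (t'a - t'P) := by
  intro ω Ls ψ hLs hψ h1 hω
  have h := forall_torusLimit_tchord_le_diagHop hU hn0 hn2 ht' hcap hfloor ω Ls ψ hLs hψ h1 hω
  rw [meanEnergy_hubbardTTPrime_diagHop_eq_bondForm hω.isTranslationInvariant] at h
  have hsum : ∑ s : Fin 2, -(1 : ℝ) * ∑ σ : Fin 2,
        ((ω.expect {0, 0 + diagVec s}
            ((cAt 0 (mem_insert_self _ _) σ)ᴴ * cAt (0 + diagVec s) (mem_insert_of_mem (mem_singleton_self _)) σ)).re +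
          (ω.expect {0, 0 + diagVec s}
            ((cAt (0 + diagVec s) (mem_insert_of_mem (mem_singleton_self _)) σ)ᴴ * cAt 0 (mem_insert_self _ _) σ)).re) =
      -(∑ s : Fin 2, ∑ σ : Fin 2,
        ((ω.expect {0, 0 + diagVec s}
            ((cAt 0 (mem_insert_self _ _) σ)ᴴ * cAt (0 + diagVec s) (mem_insert_of_mem (mem_singleton_self _)) σ)).re +
          (ω.expect {0, 0 + diagVec s}
            ((cAt (0 + diagVec s) (mem_insert_of_mem (mem_singleton_self _)) σ)ᴴ * cAt 0 (mem_insert_self _ _) σ)).re)) := by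
    rw [← Finset.sum_neg_distrib]
    exact Finset.sum_congr rfl fun s _ => by ring
  rw [hsum] at h
  have hneg : -((((lo : ℚ) : ℝ) - ((hi : ℚ) : ℝ)) / (t'a - t'P)) = (((hi : ℚ) : ℝ) - ((lo : ℚ) : ℝ)) / (t'a - t'P) := by ring
  linarith

end Summit.Ventures.CertifiedManyBodySolver.Observables

end
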